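import Summits.Ventures.PercRepro.C041CutGlueIdentity

/-!
# LEMMA G of ROW C-041 — the bound, the criterion (★) and the (INV) form (p6, gen 25; C-041.md §9, §10 (a))

From the identity `phi_glue`, with `α ≤ m₁(P, ρ₁)`, `α ≤ m₂(P, ρ₂)`:

  `Φ(glue) ≥ α·Φ(Q) + (Φ_all(P) + 2α)·#_w{V″} + Φ(P)·#_w{¬V″}`   (`phi_glue_ge`; per valid pattern
  `Φ_all + 3A₁[G₁″] + 3A₂[G₂″] ≥ α·(3[G₁″] + 3[G₂″] − 2) + Φ_all + 2α`, `per_pattern_bound`),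

hence **LEMMA G** (`phi_glue_nonneg_of_star`): `Φ(glue) ≥ 0` follows from `Φ(P) ≥ 0` ((O-CUBE) for the gadget),
`Φ(Q) ≥ 0` ((O-CUBE) for the sub-problem) and the CRITERION (★) `Φ_all(P) + 2·min_t m_t(P, ρ_t) ≥ 0`; and the
**(INV) form** of §10 (a) (`phi_glue_ge_of_INV`): with `Φ_all = Φ − 2I` (`phiAll_eq`) and `I ≤ m_t` for both sides,
`Φ(glue) ≥ I(P)·Φ(Q) + Φ(P)·N(Q)` — (O-CUBE) for `𝒫 ∪_{u″} Γ″` follows from (O-CUBE) for the pieces and (INV) for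
`(𝒫, u″)`.  The weights are the abstract ones of `C041CutGlueDefs`; the skeleton-side pairing is not typed.
-/

namespace PercRepro

namespace CutGlue

open Finset

variable {Y X : Type*}

section Counts

variable [Fintype X]

/-- `NV ≥ 0`. -/
theorem Space.NV_nonneg (S : Space X) : 0 ≤ S.NV := S.cnt_nonneg _

/-- `NnotV ≥ 0`. -/
theorem Space.NnotV_nonneg (S : Space X) : 0 ≤ S.NnotV := S.cnt_nonneg _

/-- `I ≥ 0`. -/
theorem Space.I_nonneg (S : Space X) : 0 ≤ S.I := S.cnt_nonneg _

/-- `N ≥ 0`. -/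
theorem Space.N_nonneg (S : Space X) : 0 ≤ S.N := S.cnt_nonneg _

/-- `m₁ ≥ 0`. -/
theorem Space.m₁_nonneg (S : Space X) (ρ : X → Prop) : 0 ≤ S.m₁ ρ := S.cnt_nonneg _

/-- `m₂ ≥ 0`. -/
theorem Space.m₂_nonneg (S : Space X) (ρ : X → Prop) : 0 ≤ S.m₂ ρ := S.cnt_nonneg _

end Counts

/-- **The per-pattern bound**: for `α ≤ A`, `α ≤ B`, `c + 3A[G₁] + 3B[G₂] ≥ α·wt + c + 2α`. -/
theorem per_pattern_bound (Q : Space X) (x : X) {A B α c : ℤ} (hA : α ≤ A) (hB : α ≤ B) :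
    α * Q.wt x + c + 2 * α ≤ c + 3 * A * ind (Q.G₁ x) + 3 * B * ind (Q.G₂ x) := by
  unfold Space.wt
  have h1 := ind_nonneg (Q.G₁ x)
  have h2 := ind_nonneg (Q.G₂ x)
  nlinarith [mul_le_mul_of_nonneg_right hA h1, mul_le_mul_of_nonneg_right hB h2]

variable [Fintype Y] [Fintype X]

open Classical in
/-- **THE BOUND OF LEMMA G** (C-041.md §9): for `α ≤ m₁(P, ρ₁)` and `α ≤ m₂(P, ρ₂)`,
`Φ(glue) ≥ α·Φ(Q) + (Φ_all(P) + 2α)·#_w{V″} + Φ(P)·#_w{¬V″}`. -/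
theorem phi_glue_ge (P : Space Y) (ρ₁ ρ₂ : Y → Prop) (Q : Space X) {α : ℤ} (h₁ : α ≤ P.m₁ ρ₁)
    (h₂ : α ≤ P.m₂ ρ₂) :
    α * Q.phi + (P.phiAll + 2 * α) * Q.NV + P.phi * Q.NnotV ≤ (glue P ρ₁ ρ₂ Q).phi := by
  rw [phi_glue]
  have hL : α * Q.phi + (P.phiAll + 2 * α) * Q.NV
      = ∑ x, (if Q.V x then (Q.w x : ℤ) * (α * Q.wt x + P.phiAll + 2 * α) else 0) := by
    unfold Space.phi Space.NV Space.cnt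
    rw [Finset.mul_sum, Finset.mul_sum, ← Finset.sum_add_distrib]
    apply Finset.sum_congr rfl
    intro x _
    by_cases hx : Q.V x
    · rw [if_pos hx, if_pos hx, if_pos hx]
      ring
    · rw [if_neg hx, if_neg hx, if_neg hx]
      ring
  have hsum : ∑ x, (if Q.V x then (Q.w x : ℤ) * (α * Q.wt x + P.phiAll + 2 * α) else 0)
      ≤ ∑ x, (if Q.V x then
          (Q.w x : ℤ) * (P.phiAll + 3 * P.m₁ ρ₁ * ind (Q.G₁ x) + 3 * P.m₂ ρ₂ * ind (Q.G₂ x)) else 0) := by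
    apply Finset.sum_le_sum
    intro x _
    by_cases hx : Q.V x
    · rw [if_pos hx, if_pos hx]
      exact mul_le_mul_of_nonneg_left (per_pattern_bound Q x h₁ h₂) (Nat.cast_nonneg _)
    · rw [if_neg hx, if_neg hx]
  linarith

/-- **LEMMA G** (C-041.md §9): `Φ(glue) ≥ 0` from `Φ(P) ≥ 0`, `Φ(Q) ≥ 0` and the CRITERION (★)
`Φ_all(P) + 2·min(m₁(P, ρ₁), m₂(P, ρ₂)) ≥ 0`. -/
theorem phi_glue_nonneg_of_star (P : Space Y) (ρ₁ ρ₂ : Y → Prop) (Q : Space X) (hP : 0 ≤ P.phi)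
    (hQ : 0 ≤ Q.phi) (hstar : 0 ≤ P.phiAll + 2 * min (P.m₁ ρ₁) (P.m₂ ρ₂)) : 0 ≤ (glue P ρ₁ ρ₂ Q).phi := by
  have h := phi_glue_ge P ρ₁ ρ₂ Q (min_le_left (P.m₁ ρ₁) (P.m₂ ρ₂)) (min_le_right (P.m₁ ρ₁) (P.m₂ ρ₂))
  have hα : 0 ≤ min (P.m₁ ρ₁) (P.m₂ ρ₂) := le_min (P.m₁_nonneg ρ₁) (P.m₂_nonneg ρ₂)
  have hNV := Q.NV_nonneg
  have hNnotV := Q.NnotV_nonneg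
  nlinarith [mul_nonneg hα hQ, mul_nonneg hstar hNV, mul_nonneg hP hNnotV]

/-- **(INV) ⟹ (★)**: `Φ_all(P) + 2·min_t m_t ≥ Φ(P)` when `I(P) ≤ m_t(P, ρ_t)` for both sides. -/
theorem star_of_INV (P : Space Y) (ρ₁ ρ₂ : Y → Prop) (hI₁ : P.I ≤ P.m₁ ρ₁) (hI₂ : P.I ≤ P.m₂ ρ₂) :
    P.phi ≤ P.phiAll + 2 * min (P.m₁ ρ₁) (P.m₂ ρ₂) := by
  rw [P.phiAll_eq]
  have := le_min hI₁ hI₂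
  linarith

/-- **THE (INV) FORM OF LEMMA G** (C-041.md §10 (a)): with (INV) for `(P, ρ_t)`,
`Φ(glue) ≥ I(P)·Φ(Q) + Φ(P)·N(Q)` — an exact consequence of the identity, no sign of `Φ(Q)` needed. -/
theorem phi_glue_ge_of_INV (P : Space Y) (ρ₁ ρ₂ : Y → Prop) (Q : Space X)
    (hI₁ : P.I ≤ P.m₁ ρ₁) (hI₂ : P.I ≤ P.m₂ ρ₂) :
    P.I * Q.phi + P.phi * Q.N ≤ (glue P ρ₁ ρ₂ Q).phi := by
  have h := phi_glue_ge P ρ₁ ρ₂ Q hI₁ hI₂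
  rw [P.phiAll_eq] at h
  rw [Q.N_eq]
  linarith

/-- **THE BLOCK-TREE STEP** (C-041.md §10 (a)): (O-CUBE) for the gadget and for the sub-problem together with
(INV) for the gadget give (O-CUBE) for the glue. -/
theorem phi_glue_nonneg_of_INV (P : Space Y) (ρ₁ ρ₂ : Y → Prop) (Q : Space X) (hP : 0 ≤ P.phi)
    (hQ : 0 ≤ Q.phi) (hI₁ : P.I ≤ P.m₁ ρ₁) (hI₂ : P.I ≤ P.m₂ ρ₂) : 0 ≤ (glue P ρ₁ ρ₂ Q).phi := by
  have h := phi_glue_ge_of_INV P ρ₁ ρ₂ Q hI₁ hI₂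
  have hI := P.I_nonneg
  have hN := Q.N_nonneg
  nlinarith [mul_nonneg hI hQ, mul_nonneg hP hN]

end CutGlue

end PercRepro
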